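import Summits.BirchSwinnertonDyer.BirchSwinnertonDyer.Theorems.GenusKolyvaginAtTwoKramerParityOfTwistFrame
import HarnessLib

/-!
# Route `GenusKolyvaginAtTwo`, crux #2 `GenusPrimitiveSupplyAtTwo` (stmt-BirchSwinnertonDyer-22136):
# KRAMER PARITY VIA QUADRATIC SELMER STRUCTURES, part 9 — the `huniq`-FREE form: Kramer–Mazur–Rubin parity for EVERY
# injective intertwining `φ : E'[2] → E[2]` carrying a FRAME DATUM (no uniqueness binder, no image hypothesis)

Width seat `bsd-line-gk2-p4` g12 (cell `bsd-f1-sign2`), sequel of parts 7–8 (`…KramerParityOfTwist`, `…KramerParityOfTwistFrame`).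
THEOREMS ONLY (no definition, no named fact, no `sorry`); helper `--supports stmt-BirchSwinnertonDyer-22136`; no item is closed;
BSD is not proved by any of this.

WHY. The typed fact `MazurRubin2010.kramerParity K` carries the binder `huniq` («`φ` is the ONLY injective intertwining
`E^F[2] → E[2]`»), which FAILS whenever `Aut_{Γ_K}(E[2]) ≠ 1` — e.g. for the image-`C₃` curves of the cell's T-A / T-C rows
(`F1Sign2.AdmissibleTwistSelmerShiftAtTwo`, `…EggTwistLawAtTwo`: hypothesis `NoRationalTwoTorsion` only), where Kramer's congruence is
needed for the CANONICAL identification and the typed fact is silent (`…ArchimedeanDescAdmissible`, `…ArchimedeanEggTwistLaw` docstrings).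
The engine of parts 1–4 never used `huniq`: it needs only that the transported Kummer structure `φ_* 𝓚_{E'}` be isotropic for the
Poonen–Rains forms `q_{E,v}`, and part 8 / the lead's transport law give exactly that for every `φ` carrying a FRAME DATUM (`f(T'_j) = T_{πj}`,
`x'_i − x'_j = A·(x_{πi} − x_{πj})`, `A ∈ K`). This file states the parity in that form:

* §1 `isSquare_card_selmerGroup_mul_of_isotropic_transport` — the engine of part 3 for a GIVEN second curve `E'`, injective
  intertwining `φ` and transported structure `𝓐 = φ_* 𝓚_{E'}`, with the isotropy of `𝓐` displayed (general PT family `inv`,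
  general Tate quadratic forms `q`): `#Sel₂(E') · #Sel₂(E) · ∏_{v∈S} [𝓚_v : 𝓐_v ∩ 𝓚_v]` is a square;
* §2 **`isSquare_card_selmerGroup_mul_of_frame`** — ALL inputs discharged (PT with real places, Tate χ, Weil pairing, (Q1)–(Q3) of the
  Poonen–Rains form, the transport law): for elliptic `W, W'` over a number field `K`, EVERY injective intertwining `φ : W'[2] → W[2]`
  with a frame datum `(π, A)`, and every finite `S` off which `φ_* 𝓚_{W'}` agrees with `𝓚_W`:
  **`IsSquare (#Sel₂(W') · #Sel₂(W) · ∏_{v∈S} [𝓚_{W,v} : φ_* 𝓚_{W',v} ⊓ 𝓚_{W,v}])`** — Kramer's congruence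
  `d₂(E') ≡ d₂(E) + Σ_v δ_v (mod 2)` (Kramer 1981 Thm. 1 / Mazur–Rubin 2010 Thm. 2.7 at `p = 2`) with NO uniqueness binder, NO
  non-square / twist hypothesis displayed: the frame datum is the whole input (for a twist model `C • W' = W^{(d)}` the untwisting over
  `K(√d)` restricted to `2`-torsion carries one: `x' = u²d·x + r`).

Honest framing: Kramer/Mazur–Rubin/KMR bookkeeping made `huniq`-free; every input is a tree theorem; closes nothing; crux 22136 stays OPEN
at (U) ∧ (CONV₂); BSD is not proved by any of this.

References: [KlagsbrunMazurRubin2013] Def. 3.3, Thm. 3.9, Lemma 5.2; [MazurRubin2010] Thm. 2.7, Remark 2.4, Lemma 2.9; [Kramer1981] Thm. 1;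
[PoonenRains2012] Cor. 4.6, Prop. 4.8, Thm. 4.14; [MilneADT2006] I Thm. 2.8, Thm. 4.10.
-/

set_option linter.dupNamespace false -- tree convention: `Summit.BirchSwinnertonDyer.BirchSwinnertonDyer.Theorems` (summit = sub-problem)
set_option autoImplicit false

noncomputable section

open scoped Classical ContRepresentation

namespace Summit.BirchSwinnertonDyer.BirchSwinnertonDyer.Theorems.GenusKolyKramer

open WeierstrassCurve Field NumberField IsDedekindDomain Function
open Literature.NumberTheory.EllipticCurves Literature.NumberTheory.EllipticCurves.ThetaLevelTwo
open Literature.NumberTheory.EllipticCurves.DokchitserDokchitser2012 (T xT)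
open Literature.NumberTheory.GaloisRepresentations
open Literature.NumberTheory.GaloisRepresentations.DiscreteGaloisModule (SelmerStructure)
open Literature.NumberTheory.GaloisCohomology
open Summit.BirchSwinnertonDyer.Rank1Residual
open Summit.BirchSwinnertonDyer.Rank1Residual.X11b.Relaxation

variable {K : Type} [Field K] [NumberField K]

/-! ## §1 The engine for a given transported structure, isotropy displayed -/

/-- **Kramer–Mazur–Rubin parity for a transported Kummer structure, isotropy displayed.** Data: a Poitou–Tate family `inv` (perfect,
sum of local terms zero, Selmer complement, injective at real places), Tate χ at the finite places, a Weil pairing `e` on `E[2]`, Tate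
quadratic forms `q_v` with (Q1) polar form `= inv_v ∘ ∪_e`, (Q2) Kummer isotropy, (Q3) reciprocity; a second elliptic `W'`, an
INJECTIVE intertwining `φ : W'[2] → W[2]`, the transported structure `𝓐 = φ_* 𝓚_{W'}` ISOTROPIC for the `q_v`, and a finite `S` off which
`𝓐 = 𝓚_W`. Conclusion: `#Sel₂(W') · #Sel₂(W) · ∏_{v∈S} [𝓚_{W,v} : 𝓐_v ∩ 𝓚_{W,v}]` is a perfect square. This is the body of part 3's
`kramerParity_of_tateQuadraticForms` with the twist clause replaced by the displayed isotropy (`φ` bijective from `#W'[2] = #W[2] = 4`,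
`#Sel_𝓐 = #Sel₂(W')` by transport, `#𝓐_v = #𝓚_v` from `#𝓚_v² = #H¹(K_v, ·[2])` for both curves).
[cite: KlagsbrunMazurRubin2013, Def. 3.3 and Thm. 3.9] [cite: MazurRubin2010, Thm. 2.7 and Lemma 2.9] -/
theorem isSquare_card_selmerGroup_mul_of_isotropic_transport
    (inv : LocalInvariants K 2) (hperf : inv.IsPerfect) (hsum : inv.SumLocalTermEqZero)
    (hcompl : inv.SelmerComplement) (hreal : inv.InjectiveAtRealPlaces)
    (hEP : ∀ v : HeightOneSpectrum (𝓞 K), localEulerPoincareCharacteristic (v.adicCompletion K))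
    (W : WeierstrassCurve K) [W.IsElliptic]
    (e : geomTorsion W ((2 : ℕ) : ℤ) → geomTorsion W ((2 : ℕ) : ℤ) → AlgebraicClosure K)
    (hμ : ∀ S T, e S T ^ 2 = 1)
    (hadd₁ : ∀ S₁ S₂ T, e (S₁ + S₂) T = e S₁ T * e S₂ T)
    (hadd₂ : ∀ S T₁ T₂, e S (T₁ + T₂) = e S T₁ * e S T₂)
    (hgal : ∀ (σ : absoluteGaloisGroup K) (S T : geomTorsion W ((2 : ℕ) : ℤ)), σ • e S T = e (σ • S) (σ • T))
    (halt : ∀ T, e T T = 1) (hnondeg : ∀ T, (∀ S, e S T = 1) → T = 0)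
    (q : ∀ v : Place K, galoisCohomology ((W.torsionGaloisModule ((2 : ℕ) : ℤ)).toLocal v) 1 → ZMod 2)
    (hpolar : ∀ v x y, q v (x + y) = q v x + q v y + invWeilPairing W 2 e hμ hadd₁ hadd₂ hgal inv v x y)
    (hisoK : ∀ v, ∀ x ∈ W.kummerSelmerStructure ((2 : ℕ) : ℤ) v, q v x = 0)
    (hrec : ∀ (c : galoisCohomology (W.torsionGaloisModule ((2 : ℕ) : ℤ)) 1) (S : Finset (Place K)),
      (∀ v ∉ S, q v (galoisCohomology.localization (W.torsionGaloisModule ((2 : ℕ) : ℤ)) v 1 c) = 0) →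
        ∑ v ∈ S, q v (galoisCohomology.localization (W.torsionGaloisModule ((2 : ℕ) : ℤ)) v 1 c) = 0)
    (W' : WeierstrassCurve K) [W'.IsElliptic]
    (φ : (W'.torsionGaloisModule ((2 : ℕ) : ℤ)).toContRepresentation →ⁱL
      (W.torsionGaloisModule ((2 : ℕ) : ℤ)).toContRepresentation)
    (hφ : Function.Injective φ)
    (𝓐 : SelmerStructure (W.torsionGaloisModule ((2 : ℕ) : ℤ)))
    (h𝓐 : ∀ v, 𝓐 v = (W'.kummerSelmerStructure ((2 : ℕ) : ℤ) v).map
      (galoisCohomology.map (φ.restrictField (Place.Completion v)) 1))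
    (hisoA : ∀ v, ∀ x ∈ 𝓐 v, q v x = 0)
    (S : Finset (Place K)) (hS : ∀ v ∉ S, 𝓐 v = W.kummerSelmerStructure ((2 : ℕ) : ℤ) v) :
    IsSquare (Nat.card (W'.selmerGroup ((2 : ℕ) : ℤ)) * Nat.card (W.selmerGroup ((2 : ℕ) : ℤ)) *
      ∏ v ∈ S, (𝓐 v).relIndex (W.kummerSelmerStructure ((2 : ℕ) : ℤ) v)) := by
  classical
  haveI : PerfectField K := PerfectField.ofCharZero
  -- a Weil pairing on `E'[2]` (tree theorem)
  obtain ⟨e', hμ', hadd₁', hadd₂', halt', hnondeg', hgal'⟩ :=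
    exists_weilPairing_holds W' 2 le_rfl (by norm_num)
  -- `φ` is bijective (`#E'[2] = #E[2] = 4`); its inverse
  have hcard : Nat.card (geomTorsion W' ((2 : ℕ) : ℤ)) = Nat.card (geomTorsion W ((2 : ℕ) : ℤ)) := by
    rw [W'.natCard_geomTorsion (n := ((2 : ℕ) : ℤ)) (by norm_num), W.natCard_geomTorsion (n := ((2 : ℕ) : ℤ)) (by norm_num)]
  haveI : Finite (geomTorsion W ((2 : ℕ) : ℤ)) := finite_geomTorsion_of_neZero W 2
  haveI : Finite (geomTorsion W' ((2 : ℕ) : ℤ)) := finite_geomTorsion_of_neZero W' 2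
  have hbij : Bijective φ := hφ.bijective_of_nat_card_le hcard.ge
  obtain ⟨ψ, hψφ, hφψ⟩ := exists_inverse_of_bijective φ hbij
  -- `#H¹_𝓐 = #Sel₂(E')` and `Sel₂(E) = H¹_𝓚`
  have hSelA : Nat.card 𝓐.selmerGroup = Nat.card (W'.selmerGroup ((2 : ℕ) : ℤ)) := by
    rw [W'.selmerGroup_eq_selmerGroup_kummerSelmerStructure]
    exact X11b.CongruentTransfer.natCard_selmerGroup_of_transport _ φ ψ hψφ hφψ 𝓐 h𝓐
  have hSelK : Nat.card (W.selmerGroup ((2 : ℕ) : ℤ)) =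
      Nat.card (W.kummerSelmerStructure ((2 : ℕ) : ℤ)).selmerGroup :=
    Nat.card_congr (Equiv.subtypeEquivRight fun c =>
      (W.mem_selmerGroup_iff_forall_localization_mem _ c).trans
        ((W.kummerSelmerStructure ((2 : ℕ) : ℤ)).mem_selmerGroup_iff c).symm)
  -- `#𝓐_v = #𝓚_v`
  have hcardA : ∀ v ∈ S, Nat.card (𝓐 v) = Nat.card (W.kummerSelmerStructure ((2 : ℕ) : ℤ) v) := by
    intro v _
    have h1 : Nat.card (𝓐 v) = Nat.card (W'.kummerSelmerStructure ((2 : ℕ) : ℤ) v) := by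
      rw [h𝓐 v]
      exact Nat.card_congr (AddSubgroup.equivMapOfInjective _ _
        (X11b.CongruentTransfer.map_restrictField_injective_of_comp_eq φ ψ hψφ v)).toEquiv.symm
    have h2 : Nat.card (galoisCohomology ((W'.torsionGaloisModule ((2 : ℕ) : ℤ)).toLocal v) 1) =
        Nat.card (galoisCohomology ((W.torsionGaloisModule ((2 : ℕ) : ℤ)).toLocal v) 1) := by
      refine Nat.card_eq_of_bijective (galoisCohomology.map (φ.restrictField (Place.Completion v)) 1) ⟨?_, ?_⟩
      · exact X11b.CongruentTransfer.map_restrictField_injective_of_comp_eq φ ψ hψφ v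
      · intro y
        exact ⟨galoisCohomology.map (ψ.restrictField (Place.Completion v)) 1 y,
          X11b.CongruentTransfer.map_restrictField_map_restrictField_of_comp_eq ψ φ hφψ v y⟩
    have hW := natCard_kummerSelmerStructure_mul_self W 2 e hμ hadd₁ hadd₂ hgal halt hnondeg inv
      Nat.prime_two.isPrimePow hperf hEP hreal v
    have hW' := natCard_kummerSelmerStructure_mul_self W' 2 e' hμ' hadd₁' hadd₂' hgal' halt' hnondeg' inv
      Nat.prime_two.isPrimePow hperf hEP hreal v
    rw [h1]
    rw [h2, ← hW] at hW'
    exact Nat.mul_self_inj.mp hW'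
  have key := isSquare_card_selmerGroup_mul_of_tateQuadraticForms W e hμ hadd₁ hadd₂ hgal halt hnondeg inv hperf hsum
    hcompl hreal hEP q hpolar hisoK hrec 𝓐 S hS hisoA hcardA
  rw [hSelA, ← hSelK] at key
  exact key

/-! ## §2 Kramer–Mazur–Rubin parity from a frame datum alone -/

/-- **KRAMER'S CONGRUENCE FOR EVERY FRAMED IDENTIFICATION — no uniqueness binder, every input a tree theorem.** For elliptic `W, W'`
over a number field `K`, an INJECTIVE intertwining `φ : W'[2] → W[2]` (X11b currency) carrying a FRAME DATUM — an index map `π` with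
`φ(T'_j) = T_{πj}` and `x'_i − x'_j = A·(x_{πi} − x_{πj})`, `A ∈ K` (e.g. the untwisting of a quadratic-twist model restricted to
`2`-torsion, `x' = u²d·x + r`) — the transported Kummer structure `𝓐 = φ_* 𝓚_{W'}` and every finite `S` off which `𝓐 = 𝓚_W`:
`#Sel₂(W') · #Sel₂(W) · ∏_{v∈S} [𝓚_{W,v} : 𝓐_v ∩ 𝓚_{W,v}]` is a perfect square, i.e. `d₂(W') ≡ d₂(W) + Σ_v δ_v (mod 2)` with
`2^{δ_v} = [𝓚_{W,v} : 𝓐_v ∩ 𝓚_{W,v}]` (Kramer 1981 Thm. 1; Mazur–Rubin 2010 Thm. 2.7 with Lemma 2.9; `p = 2`). Inputs, all proved in the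
tree: PT with real places (`poitouTate_selmerStructure_duality_real_holds`), Tate χ (`localEulerPoincareCharacteristic_holds`), a Weil
pairing (`exists_weilPairing_holds`), the Poonen–Rains form `q_v = can_v ∘ prClass` with (Q1) `tateQuadraticForm_prClass_Q1`, (Q2) `…_Q2`,
(Q3) `…_Q3`, and the isotropy of `𝓐` from the frame datum (part 8 `canonical_prClass_eq_zero_of_mem_map_of_frame`, the lead's
`ThetaLevelTwo.prClass_map_eq`). [cite: Kramer1981, Thm. 1] [cite: MazurRubin2010, Thm. 2.7, Remark 2.4 and Lemma 2.9]
[cite: KlagsbrunMazurRubin2013, Thm. 3.9 and Lemma 5.2] -/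
theorem isSquare_card_selmerGroup_mul_of_frame (W W' : WeierstrassCurve K) [W.IsElliptic] [W'.IsElliptic]
    (φ : (W'.torsionGaloisModule ((2 : ℕ) : ℤ)).toContRepresentation →ⁱL
      (W.torsionGaloisModule ((2 : ℕ) : ℤ)).toContRepresentation)
    (hφ : Function.Injective φ) (π : Fin 3 → Fin 3)
    (hπ : ∀ j, (show (W'.torsionGaloisModule 2).toContRepresentation →ⁱL (W.torsionGaloisModule 2).toContRepresentation
      from φ) (T W' (two_ne_zero (α := K)) j) = T W (two_ne_zero (α := K)) (π j))
    (A : K) (hA : ∀ i j, xT W' (two_ne_zero (α := K)) i - xT W' (two_ne_zero (α := K)) j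
      = algebraMap K (AlgebraicClosure K) A * (xT W (two_ne_zero (α := K)) (π i) - xT W (two_ne_zero (α := K)) (π j)))
    (𝓐 : SelmerStructure (W.torsionGaloisModule ((2 : ℕ) : ℤ)))
    (h𝓐 : ∀ v, 𝓐 v = (W'.kummerSelmerStructure ((2 : ℕ) : ℤ) v).map
      (galoisCohomology.map (φ.restrictField (Place.Completion v)) 1))
    (S : Finset (Place K)) (hS : ∀ v ∉ S, 𝓐 v = W.kummerSelmerStructure ((2 : ℕ) : ℤ) v) :
    IsSquare (Nat.card (W'.selmerGroup ((2 : ℕ) : ℤ)) * Nat.card (W.selmerGroup ((2 : ℕ) : ℤ)) *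
      ∏ v ∈ S, (𝓐 v).relIndex (W.kummerSelmerStructure ((2 : ℕ) : ℤ) v)) := by
  haveI : NeZero (2 : ℕ) := ⟨two_ne_zero⟩
  haveI : PerfectField K := PerfectField.ofCharZero
  obtain ⟨inv, hperf, hsum, -, hcompl, hreal⟩ :=
    SchneiderFreeAdditiveX3.PoitouTateReduction.poitouTate_selmerStructure_duality_real_holds (K := K) 2
  have hEP : ∀ v : HeightOneSpectrum (𝓞 K), localEulerPoincareCharacteristic (v.adicCompletion K) := fun v ↦
    haveI : CharZero (v.adicCompletion K) := charZero_of_injective_algebraMap (algebraMap K _).injective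
    localEulerPoincareCharacteristic_holds (v.adicCompletion K)
  obtain ⟨e, hμ, hadd₁, hadd₂, halt, hnondeg, hgal⟩ := exists_weilPairing_holds W 2 le_rfl (by norm_num)
  refine isSquare_card_selmerGroup_mul_of_isotropic_transport inv hperf hsum hcompl hreal hEP W e hμ hadd₁ hadd₂ hgal halt
    hnondeg
    (fun v x => LocalInvariants.canonical K 2 v (prClass W two_ne_zero (Place.Completion v)
      (show galoisCohomology ((W.torsionGaloisModule (2 : ℤ)).toLocal v) 1 from x)))
    (fun v x y => ?_)
    (fun v x hx => tateQuadraticForm_prClass_Q2 W two_ne_zero (LocalInvariants.canonical K 2) v x hx)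
    (fun c S hS => tateQuadraticForm_prClass_Q3 W two_ne_zero c S hS)
    W' φ hφ 𝓐 h𝓐 (fun v x hx => ?_) S hS
  · -- (Q1) for `can`, read through the rigidity `inv_v = can_v` on the local Weil–Tate pairings at level `2`
    rw [invWeilPairing_eq_canonical_two W e hμ hadd₁ hadd₂ hgal inv hperf hreal]
    exact tateQuadraticForm_prClass_Q1 W two_ne_zero e hμ hadd₁ hadd₂ hgal halt hnondeg (LocalInvariants.canonical K 2) v x y
  · -- isotropy of the transported structure from the frame datum (part 8)
    rw [h𝓐] at hx
    exact canonical_prClass_eq_zero_of_mem_map_of_frame W W' two_ne_zero φ π hπ A hA v x hx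

end Summit.BirchSwinnertonDyer.BirchSwinnertonDyer.Theorems.GenusKolyKramer

end
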